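import Literature.MathematicalPhysics.QuantumFieldTheory.Balaban1983to89.Beta.ColourTraceAdjoint

/-!
# `Balaban1983to89.Beta.ColourWordMatrices` — THE COLOUR MATRICES OF THE (2,2)-WORDS: every four-letter word of the polarised
plaquette kernel with two FLUCTUATION letters `t_a, t_b` and two BACKGROUND letters `t_c, t_d`, read as a matrix in `(a, b)`, is an
explicit polynomial in the ADJOINT MATRICES `A_c := adMat τ (τ c)` — except the scalar-slot word, of which only the antisymmetric
part is (`⅛·ad[t_c,t_d]`); consequently every traced weight is `tr_C` of that polynomial

(β sub-cell of `pub-balaban`, row BETA-lit1 = transfer / normalisation / colour-dictionary seat, gen 20; written on an3-g12's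
XREAD-REQUEST for `Beta.PlaquetteVertex2Words` item (b) «whether κ_w = tr_C(C_w) for the colour matrices an2's F-an2g8-1 (F2)
has in mind — which that leaf does NOT assert» and on an2-g8's (F2) «W_true = Σ_i W_i ⊗ C_i, C_i ∈ {ad t_c·ad t_c′, ad t_c′·ad t_c,
ad[t_c,t_c′], …}»; engine-certified beforehand exactly at N = 2, 4 — cell records GAPS C-lit1g20-4 — and PROVED here for every N.)

HONEST FRAMING (cell rule, verbatim): discharging `BetaPertH` makes Bałaban's UV stability UNCONDITIONAL — a real
constructive-QFT result; it is NOT the continuum limit and NOT the Clay problem.  THIS MODULE DISCHARGES NOTHING of the series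
and instantiates no binder of the wall; it asserts no VALUE of any weight of Bałaban's kernel and does not say which word occurs
with which position table (that is an3's `PlaquetteVertex2Polar`/`PlaquetteVertex2Words`).  Finite-dimensional linear algebra over
an arbitrary complete tr-orthonormal (and, where stated, Hermitian) generator family.  NOT summit progress.

ABSOLUTE RULE (cell charter, verbatim in substance).  No internally-minted statement enters as a cited fact: every hypothesis is
one of `ColourTrace.Complete` / `ColourTrace.TrOrthonormal` (definitions asserting nothing), Hermiticity of the generators, or
`N ≠ 0`; every conclusion is kernel-proved here from `Beta.ColourTrace` / `Beta.ColourTraceAdjoint`; NOTHING is cited.  Printed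
CONTEXT for the conventions = `Beta.ColourTrace`'s citation header (B9 p. 391–392, B12 (0.2), p. 289), not re-opened here.

NOTATION.  `τ : C → Mat_N(ℂ)`; letters `t_c := I•τ_c` (= an3's `PlaquetteVertex.gen τ c` by `rfl`); `[X,Y] := XY − YX`;
`A_c := adMatC τ (τ c)` (complex; for Hermitian `τ` its entries are the reals `adMat τ (τ c) a b`, `ColourTrace.adMat_coe`), the
colour matrix of `ad t_c` in the letter basis (`ColourTraceAdjoint.letter_comm_gen_eq_sum`: `[t_c, t_b] = Σ_a (A_c)_{ab} • t_a`);
`rntr := N⁻¹·Re Tr` is written out (this file imports no `PlaquetteVertex`).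

WHAT IS DERIVED (every declaration `[folklore]`; no `axiom`, no `sorry`).
* §1 COMPLEX TOOLS (complete + tr-orthonormal, `N ≠ 0`; NO Hermiticity): letter Gram form `Tr(t_e t_f) = −N·δ_ef`
  (`trace_letter_mul_letter`); expansion of a commutator factor inside a product, right and left (`mul_letterComm_eq_sum`,
  `letterComm_mul_eq_sum`); coordinate extraction `Tr(t_e · Σ_a x_a • t_a) = −N·x_e` (`trace_letter_mul_sum`) and uniqueness of
  letter coordinates (`coord_unique`); **`adMatC_ibr_gen` : adMatC τ (i[τ_c,τ_d]) = A_c A_d − A_d A_c** (the colour matrix of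
  `ad[t_c,t_d]` IS the commutator of the adjoint matrices — Jacobi, proved by coordinates); **`trace_comm_mul_comm_entry` :
  Tr([t_c,t_a][t_d,t_b]) = N·(A_c A_d)_{ab}** (the SEAGULL word is exact at the complex level).
* §2 THE THREE-LETTER TRACE (Hermitian generators, `N ≠ 0`): **`trace_letter3_re` : Re Tr(t_a t_c t_e) = −(N/2)·adMat τ (τ c) a e** —
  the real part of a three-letter trace sees only the commutator (structure-constant) part; the anticommutator (d-symbol) part is
  purely imaginary.
* §3 THE WORD TABLE at `rntr`-level (`N⁻¹·Re Tr`; complete + Hermitian, `N ≠ 0`, + tr-orthonormal for the words whose proof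
  passes through the Gram form; `A_c := adMat τ (τ c)` real):
  `N⁻¹Re Tr([t_c,t_a][t_d,t_b]) = (A_cA_d)_{ab}` (`rntr_seagull_entry`); `N⁻¹Re Tr(t_a t_c [t_d,t_b]) = −½(A_cA_d)_{ab}`
  (`rntr_mul_mul_comm_entry`); `N⁻¹Re Tr(t_a [t_c,t_b] t_d) = ½(A_dA_c)_{ab}` (`rntr_mul_comm_mul_entry`);
  `N⁻¹Re Tr([t_c,t_a] t_b t_d) = −½(A_cA_d)_{ab}` (`rntr_comm_mul_mul_entry`); `N⁻¹Re Tr(t_b [t_c,t_a] t_d) = ½(A_cA_d)_{ab}`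
  (`rntr_mul_comm_mul_entry'`); `N⁻¹Re Tr([t_c,t_b] t_a t_d) = −½(A_dA_c)_{ab}` (`rntr_comm_mul_mul_entry'`); the commutator-in-the-
  fluctuation-pair words: `N⁻¹Re Tr([t_a,t_b] t_c t_d) = ½·adMat τ (i[τ_c,τ_d]) a b` (`rntr_flucComm_mul_entry`), hence
  `N⁻¹Re(Tr(t_a Q t_b) − Tr(t_a t_b Q)) = −½·adMat τ (i[τ_c,τ_d]) a b` and `N⁻¹Re(Tr(t_a t_b Q) − Tr(t_b t_a Q)) = ½·adMat τ (i[τ_c,τ_d]) a b`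
  at `Q = t_c t_d` (`rntr_acc_entry`, `rntr_pairScalar_entry`).  DICTIONARY to an3's `PlaquetteVertex2Words` (its own ½-factors
  included): cwSeagull = ½A_cA_d; cwTrans = −¼(A_cA_d + A_dA_c); cwAcc = −¼·ad[t_c,t_d]; cwSpinR = ¼A_dA_c; cwSpinL = −¼A_cA_d;
  pwScalar = ¼·ad[t_c,t_d]; pwSpinL = −½A_cA_d; pwSpinR = ½A_dA_c; cwScalar (`½ rntr(t_at_bt_ct_d)`) is NOT of adjoint type — only
  its antisymmetric part `⅛·ad[t_c,t_d]` is (`rntr_pairScalar_entry`).  Taking `Σ_a (·)_{aa}` with `ColourTrace.trace_adMat_gen`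
  (`tr(A_cA_d) = −2N²δ`) and `ColourTraceAdjoint.trace_adMat_eq_zero` (`tr(ad X) = 0`) returns the traced weights
  `κ = (−N², N², 0, ·, −½N², ½N²; 0, N², −N²)` of `PlaquetteVertex2Words` §3 / `PlaquetteVertex2Trace` §2 — not re-proved here.
* §4 (v1.1, gen 21 — for the SYMMETRISED second-order vertex, an3's announced node «HESS-SYM»: «which of the nine C_w are
  symmetric / antisymmetric / neither as MATRICES on C × C») TRANSPOSITION CLASSES, matrix-level, from `ColourTrace.adMat_transpose`
  alone: PAIR SWAP `(A_X A_Y)ᵀ = A_Y A_X` (`adMat_mul_transpose`; cwSeagull/cwSpinL/cwSpinR/pwSpinL/pwSpinR transpose to the same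
  word type at `(d,c)`), SYMMETRIC anticommutator and square (`adMat_anticomm_transpose`, `adMat_mul_self_transpose`; cwTrans),
  ANTISYMMETRIC commutator (`adMat_comm_transpose`, `trace_adMat_comm`; for generators `= adMat τ (i[τ_c,τ_d])`:
  `adMat_gen_mul_sub_transpose`, `adMat_gen_comm_transpose`, `adMat_ibr_gen_transpose`; cwAcc/pwScalar), the split
  `A_XA_Y = ½{A_X,A_Y} + ½[A_X,A_Y]` (`adMat_mul_eq_half_anticomm_add_half_comm`, `adMat_gen_mul_decomp`), and the trace facts
  `Mᵀ = −M → trace M = 0`, `trace(½(M + Mᵀ)) = trace M` (symmetrising a word never changes its traced weight κ_w).  Every v1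
  declaration is byte-identical; nothing cited; no `def`.

References: none cited (all [folklore]).  Cell records: GAPS C-lit1g20-4 (engine certificate `p22words_colour_matrices.py`
d5aeb365621b1e36: the same identities exactly, entrywise, at N = 2 and N = 4) and the landing record of this file (v1 p189476, gen 20);
v1.1 (gen 21) = v1 + §4, APPEND-ONLY.
-/

namespace Literature.MathematicalPhysics.QuantumFieldTheory.Balaban1983to89.Beta.ColourWordMatrices

open Matrix Complex
open scoped BigOperators
open Literature.MathematicalPhysics.QuantumFieldTheory.Balaban1983to89.Beta.ColourTrace
open Literature.MathematicalPhysics.QuantumFieldTheory.Balaban1983to89.Beta.ColourTraceAdjoint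

variable {N : ℕ} {C : Type*} [Fintype C] [DecidableEq C]

/-! ## §1 Complex tools: Gram form, commutator expansions, coordinates, Jacobi, the seagull entry -/

omit [Fintype C] in
/-- LETTER GRAM FORM: `Tr(t_e t_f) = −N·δ_ef` for a tr-orthonormal family (`t = I•τ`). [folklore] -/
theorem trace_letter_mul_letter {τ : C → Matrix (Fin N) (Fin N) ℂ} (ho : TrOrthonormal τ) (e f : C) :
    ((Complex.I • τ e) * (Complex.I • τ f)).trace = -(if e = f then (N : ℂ) else 0) := by
  rw [Matrix.smul_mul, Matrix.mul_smul, smul_smul, Complex.I_mul_I, Matrix.trace_smul, ho e f, smul_eq_mul, neg_one_mul]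

omit [DecidableEq C] in
/-- RIGHT EXPANSION of a commutator factor: `M·[t_c,t_b] = Σ_e (A_c)_{eb} • (M·t_e)`. [folklore] -/
theorem mul_letterComm_eq_sum {τ : C → Matrix (Fin N) (Fin N) ℂ} (hτ : Complete τ) (hN : N ≠ 0)
    (M : Matrix (Fin N) (Fin N) ℂ) (c b : C) :
    M * ((Complex.I • τ c) * (Complex.I • τ b) - (Complex.I • τ b) * (Complex.I • τ c))
      = ∑ e, adMatC τ (τ c) e b • (M * (Complex.I • τ e)) := by
  rw [letter_comm_gen_eq_sum hτ hN c b, Finset.mul_sum]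
  refine Finset.sum_congr rfl fun e _ => ?_
  rw [Matrix.mul_smul M (adMatC τ (τ c) e b) (Complex.I • τ e)]

omit [DecidableEq C] in
/-- LEFT EXPANSION of a commutator factor: `[t_c,t_a]·M = Σ_e (A_c)_{ea} • (t_e·M)`. [folklore] -/
theorem letterComm_mul_eq_sum {τ : C → Matrix (Fin N) (Fin N) ℂ} (hτ : Complete τ) (hN : N ≠ 0)
    (M : Matrix (Fin N) (Fin N) ℂ) (c a : C) :
    ((Complex.I • τ c) * (Complex.I • τ a) - (Complex.I • τ a) * (Complex.I • τ c)) * M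
      = ∑ e, adMatC τ (τ c) e a • ((Complex.I • τ e) * M) := by
  rw [letter_comm_gen_eq_sum hτ hN c a, Finset.sum_mul]
  refine Finset.sum_congr rfl fun e _ => ?_
  rw [Matrix.smul_mul (adMatC τ (τ c) e a) (Complex.I • τ e) M]

omit [Fintype C] in
/-- the trace against a letter of a scaled letter product: `Tr(t_e · (x • t_a)) = −N·x·δ_ea`. [folklore] -/
theorem trace_letter_mul_smul_letter {τ : C → Matrix (Fin N) (Fin N) ℂ} (ho : TrOrthonormal τ) (x : ℂ) (e a : C) :
    ((Complex.I • τ e) * (x • (Complex.I • τ a))).trace = -(x * if e = a then (N : ℂ) else 0) := by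
  rw [Matrix.mul_smul (Complex.I • τ e) x (Complex.I • τ a), Matrix.trace_smul, trace_letter_mul_letter ho, smul_eq_mul,
    mul_neg]

/-- COORDINATE EXTRACTION: `Tr(t_e · Σ_a x_a • t_a) = −N·x_e`. [folklore] -/
theorem trace_letter_mul_sum {τ : C → Matrix (Fin N) (Fin N) ℂ} (ho : TrOrthonormal τ) (x : C → ℂ) (e : C) :
    ((Complex.I • τ e) * ∑ a, x a • (Complex.I • τ a)).trace = -((N : ℂ) * x e) := by
  rw [Finset.mul_sum, Matrix.trace_sum]
  simp_rw [trace_letter_mul_smul_letter ho, mul_ite, mul_zero]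
  rw [Finset.sum_neg_distrib, Finset.sum_ite_eq Finset.univ e]
  simp [mul_comm]

/-- UNIQUENESS OF LETTER COORDINATES (tr-orthonormal, `N ≠ 0`): equal letter combinations have equal coefficients. [folklore] -/
theorem coord_unique {τ : C → Matrix (Fin N) (Fin N) ℂ} (ho : TrOrthonormal τ) (hN : N ≠ 0) {x y : C → ℂ}
    (h : ∑ a, x a • (Complex.I • τ a) = ∑ a, y a • (Complex.I • τ a)) : x = y := by
  funext e
  have h1 := trace_letter_mul_sum ho x e
  rw [h, trace_letter_mul_sum ho y e, neg_inj] at h1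
  have hN' : (N : ℂ) ≠ 0 := Nat.cast_ne_zero.mpr hN
  exact (mul_right_injective₀ hN' h1).symm

omit [Fintype C] [DecidableEq C] in
/-- the letter commutator is `I •` the Hermitian bracket: `[t_c, t_d] = I • i[τ_c, τ_d]` (`ibr X Y = I•(XY − YX)`). [folklore] -/
theorem letterComm_eq_smul_ibr (τ : C → Matrix (Fin N) (Fin N) ℂ) (c d : C) :
    (Complex.I • τ c) * (Complex.I • τ d) - (Complex.I • τ d) * (Complex.I • τ c) = Complex.I • ibr (τ c) (τ d) := by
  rw [letter_comm_eq_neg, ibr, smul_smul, Complex.I_mul_I, neg_one_smul]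

omit [DecidableEq C] in
/-- a letter commutator is linear in a letter combination: `[t_c, Σ_f x_f • t_f] = Σ_f x_f • [t_c, t_f]`. [folklore] -/
theorem letterComm_sum_smul (τ : C → Matrix (Fin N) (Fin N) ℂ) (c : C) (x : C → ℂ) :
    (Complex.I • τ c) * (∑ f, x f • (Complex.I • τ f)) - (∑ f, x f • (Complex.I • τ f)) * (Complex.I • τ c)
      = ∑ f, x f • ((Complex.I • τ c) * (Complex.I • τ f) - (Complex.I • τ f) * (Complex.I • τ c)) := by
  rw [Finset.mul_sum, Finset.sum_mul, ← Finset.sum_sub_distrib]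
  refine Finset.sum_congr rfl fun f _ => ?_
  rw [Matrix.mul_smul (Complex.I • τ c) (x f) (Complex.I • τ f), Matrix.smul_mul (x f) (Complex.I • τ f) (Complex.I • τ c),
    smul_sub]

omit [DecidableEq C] in
/-- … and in coordinates: `[t_c, Σ_f x_f • t_f] = Σ_e (A_c x)_e • t_e` (complete, `N ≠ 0`). [folklore] -/
theorem letterComm_sum_eq {τ : C → Matrix (Fin N) (Fin N) ℂ} (hτ : Complete τ) (hN : N ≠ 0) (c : C) (x : C → ℂ) :
    (Complex.I • τ c) * (∑ f, x f • (Complex.I • τ f)) - (∑ f, x f • (Complex.I • τ f)) * (Complex.I • τ c)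
      = ∑ e, (∑ f, adMatC τ (τ c) e f * x f) • (Complex.I • τ e) := by
  rw [letterComm_sum_smul]
  have h : ∀ f, x f • ((Complex.I • τ c) * (Complex.I • τ f) - (Complex.I • τ f) * (Complex.I • τ c))
      = ∑ e, (adMatC τ (τ c) e f * x f) • (Complex.I • τ e) := by
    intro f
    rw [letter_comm_gen_eq_sum hτ hN c f, Finset.smul_sum]
    refine Finset.sum_congr rfl fun e _ => ?_
    rw [smul_smul, mul_comm]
  simp_rw [h]
  rw [Finset.sum_comm]
  refine Finset.sum_congr rfl fun e _ => ?_
  rw [Finset.sum_smul]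

omit [Fintype C] [DecidableEq C] in
/-- Jacobi as a ring identity: `[[X,Y],Z] = [X,[Y,Z]] − [Y,[X,Z]]`. [folklore] -/
theorem comm_comm_eq (X Y Z : Matrix (Fin N) (Fin N) ℂ) :
    (X * Y - Y * X) * Z - Z * (X * Y - Y * X) = (X * (Y * Z - Z * Y) - (Y * Z - Z * Y) * X) - (Y * (X * Z - Z * X) - (X * Z - Z * X) * Y) := by
  noncomm_ring

/-- **JACOBI IN COORDINATES**: the colour matrix of `ad[t_c,t_d]` — i.e. `adMatC τ (i[τ_c,τ_d])`, by
`ColourTraceAdjoint.letter_comm_eq_sum` at `X = i[τ_c,τ_d]` and `[t_c,t_d] = I•i[τ_c,τ_d]` — IS the commutator of the adjoint matrices: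
`adMatC τ (ibr (τ c) (τ d)) = A_c·A_d − A_d·A_c` (complete + tr-orthonormal, `N ≠ 0`). [folklore] -/
theorem adMatC_ibr_gen {τ : C → Matrix (Fin N) (Fin N) ℂ} (hτ : Complete τ) (ho : TrOrthonormal τ) (hN : N ≠ 0) (c d : C) :
    adMatC τ (ibr (τ c) (τ d)) = adMatC τ (τ c) * adMatC τ (τ d) - adMatC τ (τ d) * adMatC τ (τ c) := by
  have key : ∀ b, ∑ e, adMatC τ (ibr (τ c) (τ d)) e b • (Complex.I • τ e)
      = ∑ e, (adMatC τ (τ c) * adMatC τ (τ d) - adMatC τ (τ d) * adMatC τ (τ c)) e b • (Complex.I • τ e) := by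
    intro b
    rw [← letter_comm_eq_sum hτ hN (ibr (τ c) (τ d)) b, ← letterComm_eq_smul_ibr,
      comm_comm_eq (Complex.I • τ c) (Complex.I • τ d) (Complex.I • τ b),
      letter_comm_gen_eq_sum hτ hN d b, letter_comm_gen_eq_sum hτ hN c b, letterComm_sum_eq hτ hN c, letterComm_sum_eq hτ hN d,
      ← Finset.sum_sub_distrib]
    refine Finset.sum_congr rfl fun e _ => ?_
    rw [← sub_smul, Matrix.sub_apply, Matrix.mul_apply, Matrix.mul_apply]
  ext a b
  exact congrFun (coord_unique ho hN (key b)) a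

/-- **THE SEAGULL WORD, ENTRYWISE AND EXACT**: `Tr([t_c,t_a]·[t_d,t_b]) = N·(A_c·A_d)_{ab}` (complete + tr-orthonormal, `N ≠ 0`;
complex identity, no Hermiticity). [folklore] -/
theorem trace_comm_mul_comm_entry {τ : C → Matrix (Fin N) (Fin N) ℂ} (hτ : Complete τ) (ho : TrOrthonormal τ) (hN : N ≠ 0)
    (a b c d : C) :
    (((Complex.I • τ c) * (Complex.I • τ a) - (Complex.I • τ a) * (Complex.I • τ c))
        * ((Complex.I • τ d) * (Complex.I • τ b) - (Complex.I • τ b) * (Complex.I • τ d))).trace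
      = (N : ℂ) * (adMatC τ (τ c) * adMatC τ (τ d)) a b := by
  rw [letter_comm_gen_eq_sum hτ hN d b, letterComm_mul_eq_sum hτ hN _ c a, Matrix.trace_sum]
  have h : ∀ e, (adMatC τ (τ c) e a • ((Complex.I • τ e) * ∑ f, adMatC τ (τ d) f b • (Complex.I • τ f))).trace
      = -((N : ℂ) * (adMatC τ (τ c) e a * adMatC τ (τ d) e b)) := by
    intro e
    rw [Matrix.trace_smul, trace_letter_mul_sum ho, smul_eq_mul]
    ring
  simp_rw [h]
  rw [Finset.sum_neg_distrib, Matrix.mul_apply, Finset.mul_sum, ← Finset.sum_neg_distrib]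
  refine Finset.sum_congr rfl fun e _ => ?_
  rw [adMatC_antisymm τ (τ c) a e]
  ring

/-! ## §2 The three-letter trace (Hermitian generators) -/

omit [Fintype C] [DecidableEq C] in
/-- for Hermitian generators `Tr(τ_a τ_e τ_c) = conj Tr(τ_a τ_c τ_e)`: real parts agree, imaginary parts are opposite. [folklore] -/
theorem trace_gen3_swap_re_im {τ : C → Matrix (Fin N) (Fin N) ℂ} (hH : ∀ c, (τ c).IsHermitian) (a c e : C) :
    ((τ a * τ e * τ c).trace).re = ((τ a * τ c * τ e).trace).re
      ∧ ((τ a * τ e * τ c).trace).im = -((τ a * τ c * τ e).trace).im := by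
  have hs : star (τ a * τ c * τ e).trace = (τ a * τ e * τ c).trace := by
    rw [← Matrix.trace_conjTranspose, Matrix.conjTranspose_mul, Matrix.conjTranspose_mul, (hH a).eq, (hH c).eq, (hH e).eq,
      ← Matrix.mul_assoc, Matrix.trace_mul_cycle]
  refine ⟨?_, ?_⟩
  · rw [← hs, Complex.star_def, Complex.conj_re]
  · rw [← hs, Complex.star_def, Complex.conj_im]

omit [Fintype C] [DecidableEq C] in
/-- three letters: `Tr(t_a t_c t_e) = −I·Tr(τ_a τ_c τ_e)`. [folklore] -/
theorem trace_letter3_eq (τ : C → Matrix (Fin N) (Fin N) ℂ) (a c e : C) :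
    ((Complex.I • τ a) * (Complex.I • τ c) * (Complex.I • τ e)).trace = -(Complex.I * (τ a * τ c * τ e).trace) := by
  simp only [Matrix.smul_mul, Matrix.mul_smul, smul_smul, Matrix.trace_smul, smul_eq_mul]
  linear_combination (Complex.I * (τ a * τ c * τ e).trace) * Complex.I_mul_I

omit [Fintype C] [DecidableEq C] in
/-- **THE THREE-LETTER TRACE**: `Re Tr(t_a t_c t_e) = −(N/2)·adMat τ (τ c) a e` (Hermitian generators, `N ≠ 0`) — the real part of a
three-letter trace is the structure-constant part; the `d`-symbol part is purely imaginary. [folklore] -/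
theorem trace_letter3_re {τ : C → Matrix (Fin N) (Fin N) ℂ} (hH : ∀ c, (τ c).IsHermitian) (hN : N ≠ 0) (a c e : C) :
    (((Complex.I • τ a) * (Complex.I • τ c) * (Complex.I • τ e)).trace).re = -((N : ℝ) / 2) * adMat τ (τ c) a e := by
  have hcyc : (τ c * τ a * τ e).trace = (τ a * τ e * τ c).trace := by
    rw [Matrix.trace_mul_cycle, Matrix.trace_mul_cycle]
  obtain ⟨hre, him⟩ := trace_gen3_swap_re_im hH a c e
  have h2 : adMat τ (τ c) a e = -(2 / (N : ℝ)) * ((τ a * τ c * τ e).trace).im := by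
    rw [adMat_apply, adMatC_apply, Matrix.sub_mul, Matrix.trace_sub, hcyc, Complex.mul_re, Complex.sub_re, Complex.sub_im,
      hre, him, sub_self, mul_zero, zero_sub]
    have : (Complex.I / (N : ℂ)).im = 1 / (N : ℝ) := by simp [Complex.div_im, Complex.normSq_natCast]
    rw [this]
    ring
  have hN' : (N : ℝ) ≠ 0 := Nat.cast_ne_zero.mpr hN
  rw [trace_letter3_eq, Complex.neg_re, Complex.mul_re, Complex.I_re, Complex.I_im, zero_mul, one_mul, zero_sub, neg_neg, h2]
  field_simp

/-! ## §3 The word table at `rntr`-level (`N⁻¹·Re Tr`) -/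

section Words

variable {τ : C → Matrix (Fin N) (Fin N) ℂ}

omit [Fintype C] [DecidableEq C] in
/-- for Hermitian generators the complex adjoint matrix of a generator is the real one, coerced. [folklore] -/
theorem adMatC_gen_eq_map (hH : ∀ c, (τ c).IsHermitian) (c : C) :
    adMatC τ (τ c) = (adMat τ (τ c)).map Complex.ofRealHom := by
  ext a b
  rw [Matrix.map_apply, Complex.ofRealHom_eq_coe, adMat_coe hH (hH c)]

omit [DecidableEq C] in
/-- … hence products of two of them are real matrices, coerced. [folklore] -/
theorem adMatC_mul_gen_eq_map (hH : ∀ c, (τ c).IsHermitian) (c d : C) :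
    adMatC τ (τ c) * adMatC τ (τ d) = (adMat τ (τ c) * adMat τ (τ d)).map Complex.ofRealHom := by
  rw [adMatC_gen_eq_map hH c, adMatC_gen_eq_map hH d, Matrix.map_mul]

/-- **SEAGULL** (an3's `cwSeagull` = ½ of this): `N⁻¹·Re Tr([t_c,t_a][t_d,t_b]) = (A_c·A_d)_{ab}` with the REAL adjoint matrices
(complete + tr-orthonormal + Hermitian, `N ≠ 0`). [folklore] -/
theorem rntr_seagull_entry (hτ : Complete τ) (ho : TrOrthonormal τ) (hH : ∀ c, (τ c).IsHermitian) (hN : N ≠ 0) (a b c d : C) :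
    (N : ℝ)⁻¹ * (((Complex.I • τ c) * (Complex.I • τ a) - (Complex.I • τ a) * (Complex.I • τ c))
        * ((Complex.I • τ d) * (Complex.I • τ b) - (Complex.I • τ b) * (Complex.I • τ d))).trace.re
      = (adMat τ (τ c) * adMat τ (τ d)) a b := by
  have hN' : (N : ℝ) ≠ 0 := Nat.cast_ne_zero.mpr hN
  rw [trace_comm_mul_comm_entry hτ ho hN, adMatC_mul_gen_eq_map hH, Matrix.map_apply, Complex.ofRealHom_eq_coe,
    ← Complex.ofReal_natCast, ← Complex.ofReal_mul, Complex.ofReal_re]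
  field_simp

omit [Fintype C] [DecidableEq C] in
/-- index swap of generator adjoint matrices (trace cyclicity, no hypothesis): `(A_e)_{ad} = −(A_d)_{ae}` — total antisymmetry of the
structure constants. [folklore] -/
theorem adMatC_gen_swap (τ : C → Matrix (Fin N) (Fin N) ℂ) (a d e : C) : adMatC τ (τ e) a d = -adMatC τ (τ d) a e := by
  rw [adMatC_apply, adMatC_apply, Matrix.sub_mul, Matrix.sub_mul, Matrix.trace_sub, Matrix.trace_sub]
  have h1 : (τ e * τ a * τ d).trace = (τ a * τ d * τ e).trace := by rw [Matrix.trace_mul_cycle, Matrix.trace_mul_cycle]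
  have h2 : (τ d * τ a * τ e).trace = (τ a * τ e * τ d).trace := by rw [Matrix.trace_mul_cycle, Matrix.trace_mul_cycle]
  rw [h1, h2]
  ring

omit [Fintype C] [DecidableEq C] in
/-- real form of the index swap. [folklore] -/
theorem adMat_gen_swap (τ : C → Matrix (Fin N) (Fin N) ℂ) (a d e : C) : adMat τ (τ e) a d = -adMat τ (τ d) a e := by
  rw [adMat_apply, adMat_apply, adMatC_gen_swap, Complex.neg_re]

omit [DecidableEq C] in
/-- products of two generator adjoint matrices, transposed: `(A_X A_Y)_{ba} = (A_Y A_X)_{ab}` (both factors antisymmetric). [folklore] -/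
theorem adMat_mul_apply_swap (τ : C → Matrix (Fin N) (Fin N) ℂ) (X Y : Matrix (Fin N) (Fin N) ℂ) (a b : C) :
    (adMat τ X * adMat τ Y) b a = (adMat τ Y * adMat τ X) a b := by
  rw [Matrix.mul_apply, Matrix.mul_apply]
  refine Finset.sum_congr rfl fun e _ => ?_
  rw [show adMat τ X b e = -adMat τ X e b by rw [← Matrix.transpose_apply (adMat τ X) e b, adMat_transpose, Matrix.neg_apply],
    show adMat τ Y e a = -adMat τ Y a e by rw [← Matrix.transpose_apply (adMat τ Y) a e, adMat_transpose, Matrix.neg_apply]]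
  ring

omit [DecidableEq C] in
/-- a real sum against complex values with generator-adjoint coefficients (Hermitian generators):
`Re Σ_e (A_c)_{ei} z_e = Σ_e (A_c)_{ei} Re z_e`. [folklore] -/
theorem re_sum_adMatC_mul (hH : ∀ c, (τ c).IsHermitian) (c i : C) (z : C → ℂ) :
    (∑ e, adMatC τ (τ c) e i * z e).re = ∑ e, adMat τ (τ c) e i * (z e).re := by
  rw [Complex.re_sum]
  refine Finset.sum_congr rfl fun e _ => ?_
  rw [← adMat_coe hH (hH c), Complex.re_ofReal_mul]

omit [DecidableEq C] in
/-- **SECOND-ORDER TRANSPORT WORD** (first half of an3's `cwTrans`): `N⁻¹·Re Tr(t_a t_c [t_d,t_b]) = −½(A_c·A_d)_{ab}`. [folklore] -/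
theorem rntr_mul_mul_comm_entry (hτ : Complete τ) (hH : ∀ c, (τ c).IsHermitian) (hN : N ≠ 0)
    (a b c d : C) :
    (N : ℝ)⁻¹ * ((Complex.I • τ a) * (Complex.I • τ c)
        * ((Complex.I • τ d) * (Complex.I • τ b) - (Complex.I • τ b) * (Complex.I • τ d))).trace.re
      = -2⁻¹ * (adMat τ (τ c) * adMat τ (τ d)) a b := by
  have hN' : (N : ℝ) ≠ 0 := Nat.cast_ne_zero.mpr hN
  rw [mul_letterComm_eq_sum hτ hN _ d b, Matrix.trace_sum]
  simp_rw [Matrix.trace_smul, smul_eq_mul]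
  rw [re_sum_adMatC_mul hH d b, Matrix.mul_apply, Finset.mul_sum, Finset.mul_sum]
  refine Finset.sum_congr rfl fun f _ => ?_
  rw [trace_letter3_re hH hN a c f]
  field_simp

omit [DecidableEq C] in
/-- **SPIN / TRANSPORT WORD** (an3's `cwSpinR` = ½ of this; second half of `cwTrans`): `N⁻¹·Re Tr(t_a [t_c,t_b] t_d) = ½(A_d·A_c)_{ab}`.
[folklore] -/
theorem rntr_mul_comm_mul_entry (hτ : Complete τ) (hH : ∀ c, (τ c).IsHermitian) (hN : N ≠ 0)
    (a b c d : C) :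
    (N : ℝ)⁻¹ * ((Complex.I • τ a) * ((Complex.I • τ c) * (Complex.I • τ b) - (Complex.I • τ b) * (Complex.I • τ c))
        * (Complex.I • τ d)).trace.re
      = 2⁻¹ * (adMat τ (τ d) * adMat τ (τ c)) a b := by
  have hN' : (N : ℝ) ≠ 0 := Nat.cast_ne_zero.mpr hN
  rw [mul_letterComm_eq_sum hτ hN _ c b, Finset.sum_mul, Matrix.trace_sum]
  have h : ∀ e, ((adMatC τ (τ c) e b • ((Complex.I • τ a) * (Complex.I • τ e))) * (Complex.I • τ d)).trace
      = adMatC τ (τ c) e b * ((Complex.I • τ a) * (Complex.I • τ e) * (Complex.I • τ d)).trace := by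
    intro e
    rw [Matrix.smul_mul, Matrix.trace_smul, smul_eq_mul]
  simp_rw [h]
  rw [re_sum_adMatC_mul hH c b, Matrix.mul_apply, Finset.mul_sum, Finset.mul_sum]
  refine Finset.sum_congr rfl fun e _ => ?_
  rw [trace_letter3_re hH hN a e d, adMat_gen_swap τ a d e]
  field_simp

omit [DecidableEq C] in
/-- **SPIN WORD, LEFT** (an3's `cwSpinL` = ½ of this): `N⁻¹·Re Tr([t_c,t_a] t_b t_d) = −½(A_c·A_d)_{ab}`. [folklore] -/
theorem rntr_comm_mul_mul_entry (hτ : Complete τ) (hH : ∀ c, (τ c).IsHermitian) (hN : N ≠ 0)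
    (a b c d : C) :
    (N : ℝ)⁻¹ * (((Complex.I • τ c) * (Complex.I • τ a) - (Complex.I • τ a) * (Complex.I • τ c)) * (Complex.I • τ b)
        * (Complex.I • τ d)).trace.re
      = -2⁻¹ * (adMat τ (τ c) * adMat τ (τ d)) a b := by
  have hN' : (N : ℝ) ≠ 0 := Nat.cast_ne_zero.mpr hN
  rw [letterComm_mul_eq_sum hτ hN _ c a, Finset.sum_mul, Matrix.trace_sum]
  have h : ∀ e, ((adMatC τ (τ c) e a • ((Complex.I • τ e) * (Complex.I • τ b))) * (Complex.I • τ d)).trace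
      = adMatC τ (τ c) e a * ((Complex.I • τ e) * (Complex.I • τ b) * (Complex.I • τ d)).trace := by
    intro e
    rw [Matrix.smul_mul, Matrix.trace_smul, smul_eq_mul]
  simp_rw [h]
  rw [re_sum_adMatC_mul hH c a, Matrix.mul_apply, Finset.mul_sum, Finset.mul_sum]
  refine Finset.sum_congr rfl fun e _ => ?_
  rw [trace_letter3_re hH hN e b d, adMat_gen_swap τ e d b,
    show adMat τ (τ c) e a = -adMat τ (τ c) a e by
      rw [← Matrix.transpose_apply (adMat τ (τ c)) a e, adMat_transpose, Matrix.neg_apply]]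
  field_simp

omit [DecidableEq C] in
/-- **PAIR SPIN WORD, LEFT** (second term of an3's `pwSpinL`): `N⁻¹·Re Tr(t_b [t_c,t_a] t_d) = ½(A_c·A_d)_{ab}`. [folklore] -/
theorem rntr_mul_comm_mul_entry' (hτ : Complete τ) (hH : ∀ c, (τ c).IsHermitian) (hN : N ≠ 0)
    (a b c d : C) :
    (N : ℝ)⁻¹ * ((Complex.I • τ b) * ((Complex.I • τ c) * (Complex.I • τ a) - (Complex.I • τ a) * (Complex.I • τ c))
        * (Complex.I • τ d)).trace.re
      = 2⁻¹ * (adMat τ (τ c) * adMat τ (τ d)) a b := by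
  rw [rntr_mul_comm_mul_entry hτ hH hN b a c d, adMat_mul_apply_swap]

omit [DecidableEq C] in
/-- **PAIR SPIN WORD, RIGHT** (second term of an3's `pwSpinR`): `N⁻¹·Re Tr([t_c,t_b] t_a t_d) = −½(A_d·A_c)_{ab}`. [folklore] -/
theorem rntr_comm_mul_mul_entry' (hτ : Complete τ) (hH : ∀ c, (τ c).IsHermitian) (hN : N ≠ 0)
    (a b c d : C) :
    (N : ℝ)⁻¹ * (((Complex.I • τ c) * (Complex.I • τ b) - (Complex.I • τ b) * (Complex.I • τ c)) * (Complex.I • τ a)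
        * (Complex.I • τ d)).trace.re
      = -2⁻¹ * (adMat τ (τ d) * adMat τ (τ c)) a b := by
  rw [rntr_comm_mul_mul_entry hτ hH hN b a c d, adMat_mul_apply_swap]

/-- **THE FLUCTUATION-PAIR COMMUTATOR AGAINST ANY LETTER WORD, EXACT**: `Tr([t_a,t_b]·(I•X)) = N·adMatC τ X a b` for EVERY `X`
(complete + tr-orthonormal, `N ≠ 0`; complex identity). [folklore] -/
theorem trace_flucComm_mul (hτ : Complete τ) (ho : TrOrthonormal τ) (hN : N ≠ 0) (a b : C) (X : Matrix (Fin N) (Fin N) ℂ) :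
    (((Complex.I • τ a) * (Complex.I • τ b) - (Complex.I • τ b) * (Complex.I • τ a)) * (Complex.I • X)).trace
      = (N : ℂ) * adMatC τ X a b := by
  have hcyc : ((Complex.I • τ b) * (Complex.I • τ a) * (Complex.I • X)).trace
      = ((Complex.I • τ a) * ((Complex.I • X) * (Complex.I • τ b))).trace := by
    rw [Matrix.mul_assoc, Matrix.trace_mul_comm, Matrix.mul_assoc]
  rw [Matrix.sub_mul, Matrix.trace_sub, hcyc, Matrix.mul_assoc, ← Matrix.trace_sub, ← Matrix.mul_sub,
    show (Complex.I • τ b) * (Complex.I • X) - (Complex.I • X) * (Complex.I • τ b)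
      = -((Complex.I • X) * (Complex.I • τ b) - (Complex.I • τ b) * (Complex.I • X)) by rw [neg_sub],
    Matrix.mul_neg, Matrix.trace_neg, letter_comm_eq_sum hτ hN X b, trace_letter_mul_sum ho, neg_neg]

omit [Fintype C] [DecidableEq C] in
/-- the anticommutator of two Hermitian generators is Hermitian. [folklore] -/
theorem isHermitian_anticomm (hH : ∀ c, (τ c).IsHermitian) (c d : C) : (τ c * τ d + τ d * τ c).IsHermitian := by
  unfold Matrix.IsHermitian
  rw [Matrix.conjTranspose_add, Matrix.conjTranspose_mul, Matrix.conjTranspose_mul, (hH c).eq, (hH d).eq, add_comm]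

omit [Fintype C] [DecidableEq C] in
/-- the letter product `t_c t_d` as `I •` half bracket plus half anticommutator: `t_c t_d = I•(½·i[τ_c,τ_d] + ½·I•{τ_c,τ_d})`.
[folklore] -/
theorem letter_mul_letter_eq (τ : C → Matrix (Fin N) (Fin N) ℂ) (c d : C) :
    (Complex.I • τ c) * (Complex.I • τ d)
      = Complex.I • ((2⁻¹ : ℂ) • ibr (τ c) (τ d) + (2⁻¹ : ℂ) • (Complex.I • (τ c * τ d + τ d * τ c))) := by
  rw [ibr]
  simp only [Matrix.smul_mul, Matrix.mul_smul, smul_smul, smul_sub, smul_add]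
  module

/-- **THE FLUCTUATION-PAIR COMMUTATOR WORD** (an3's `pwScalar` = ½ of this; the antisymmetric part of `cwScalar` = ¼ of this):
`N⁻¹·Re Tr([t_a,t_b] t_c t_d) = ½·adMat τ (i[τ_c,τ_d]) a b` — the real part sees only the bracket half of `t_c t_d`; by
`adMatC_ibr_gen` the matrix `adMat τ (i[τ_c,τ_d])` is the real commutator `A_cA_d − A_dA_c` for Hermitian generators. [folklore] -/
theorem rntr_flucComm_mul_entry (hτ : Complete τ) (ho : TrOrthonormal τ) (hH : ∀ c, (τ c).IsHermitian) (hN : N ≠ 0)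
    (a b c d : C) :
    (N : ℝ)⁻¹ * ((((Complex.I • τ a) * (Complex.I • τ b) - (Complex.I • τ b) * (Complex.I • τ a))
        * ((Complex.I • τ c) * (Complex.I • τ d))).trace).re
      = 2⁻¹ * adMat τ (ibr (τ c) (τ d)) a b := by
  have hN' : (N : ℝ) ≠ 0 := Nat.cast_ne_zero.mpr hN
  rw [letter_mul_letter_eq τ c d, trace_flucComm_mul hτ ho hN, adMatC_add, adMatC_smul, adMatC_smul, adMatC_smul,
    Matrix.add_apply, Matrix.smul_apply, Matrix.smul_apply, Matrix.smul_apply, smul_eq_mul, smul_eq_mul, smul_eq_mul,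
    adMat_apply]
  have hreal : (adMatC τ (τ c * τ d + τ d * τ c) a b).im = 0 := adMatC_im hH (isHermitian_anticomm hH c d) a b
  have hN2 : ((N : ℂ) * (2⁻¹ * adMatC τ (ibr (τ c) (τ d)) a b + 2⁻¹ * (Complex.I * adMatC τ (τ c * τ d + τ d * τ c) a b))).re
      = (N : ℝ) * (2⁻¹ * (adMatC τ (ibr (τ c) (τ d)) a b).re) := by
    rw [show (N : ℂ) = ((N : ℝ) : ℂ) by norm_cast, Complex.re_ofReal_mul, Complex.add_re]
    congr 1
    rw [show (2⁻¹ : ℂ) = ((2⁻¹ : ℝ) : ℂ) by norm_num, Complex.re_ofReal_mul, Complex.re_ofReal_mul, Complex.mul_re,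
      Complex.I_re, Complex.I_im, hreal, zero_mul, mul_zero, sub_zero, mul_zero, add_zero]
  rw [hN2]
  field_simp

/-- **ACCUMULATED-COMMUTATOR WORD** (an3's `cwAcc` = ½ of this): `N⁻¹·Re(Tr(t_a Q t_b) − Tr(t_a t_b Q)) = −½·adMat τ (i[τ_c,τ_d]) a b`
at `Q = t_c t_d` — trace of an `ad`, hence weight `0` (`ColourTraceAdjoint.trace_adMat_eq_zero`). [folklore] -/
theorem rntr_acc_entry (hτ : Complete τ) (ho : TrOrthonormal τ) (hH : ∀ c, (τ c).IsHermitian) (hN : N ≠ 0) (a b c d : C) :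
    (N : ℝ)⁻¹ * (((Complex.I • τ a) * ((Complex.I • τ c) * (Complex.I • τ d)) * (Complex.I • τ b)).trace
        - ((Complex.I • τ a) * (Complex.I • τ b) * ((Complex.I • τ c) * (Complex.I • τ d))).trace).re
      = -2⁻¹ * adMat τ (ibr (τ c) (τ d)) a b := by
  have hcyc : ((Complex.I • τ a) * ((Complex.I • τ c) * (Complex.I • τ d)) * (Complex.I • τ b)).trace
      = ((Complex.I • τ b) * (Complex.I • τ a) * ((Complex.I • τ c) * (Complex.I • τ d))).trace := by
    rw [Matrix.trace_mul_cycle, Matrix.mul_assoc]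
  rw [hcyc, ← Matrix.trace_sub, ← Matrix.sub_mul,
    show (Complex.I • τ b) * (Complex.I • τ a) - (Complex.I • τ a) * (Complex.I • τ b)
      = -((Complex.I • τ a) * (Complex.I • τ b) - (Complex.I • τ b) * (Complex.I • τ a)) by rw [neg_sub],
    Matrix.neg_mul, Matrix.trace_neg, Complex.neg_re, mul_neg, rntr_flucComm_mul_entry hτ ho hH hN]
  ring

/-- **PAIR SCALAR WORD** (an3's `pwScalar` = ½ of this): `N⁻¹·Re(Tr(t_a t_b Q) − Tr(t_b t_a Q)) = ½·adMat τ (i[τ_c,τ_d]) a b` at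
`Q = t_c t_d` — again the trace-free `ad[t_c,t_d]`. [folklore] -/
theorem rntr_pairScalar_entry (hτ : Complete τ) (ho : TrOrthonormal τ) (hH : ∀ c, (τ c).IsHermitian) (hN : N ≠ 0)
    (a b c d : C) :
    (N : ℝ)⁻¹ * (((Complex.I • τ a) * (Complex.I • τ b) * ((Complex.I • τ c) * (Complex.I • τ d))).trace
        - ((Complex.I • τ b) * (Complex.I • τ a) * ((Complex.I • τ c) * (Complex.I • τ d))).trace).re
      = 2⁻¹ * adMat τ (ibr (τ c) (τ d)) a b := by
  rw [← Matrix.trace_sub, ← Matrix.sub_mul, rntr_flucComm_mul_entry hτ ho hH hN]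

/-- real JACOBI: for Hermitian generators `adMat τ (i[τ_c,τ_d]) = A_c·A_d − A_d·A_c` with the REAL matrices. [folklore] -/
theorem adMat_ibr_gen (hτ : Complete τ) (ho : TrOrthonormal τ) (hH : ∀ c, (τ c).IsHermitian) (hN : N ≠ 0) (c d : C) :
    adMat τ (ibr (τ c) (τ d)) = adMat τ (τ c) * adMat τ (τ d) - adMat τ (τ d) * adMat τ (τ c) := by
  ext a b
  rw [adMat_apply, adMatC_ibr_gen hτ ho hN, Matrix.sub_apply, Complex.sub_re, adMatC_mul_gen_eq_map hH,
    adMatC_mul_gen_eq_map hH, Matrix.map_apply, Matrix.map_apply, Complex.ofRealHom_eq_coe, Complex.ofRealHom_eq_coe,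
    Complex.ofReal_re, Complex.ofReal_re, Matrix.sub_apply]

end Words

/-! ## §4 Transposition classes of the word colour matrices (v1.1; for the SYMMETRISED (2,2)-vertex — an3's «HESS-SYM»)

Read as REAL matrices on `C × C`, the colour matrices of §3 fall into three classes under transposition; every statement
below is a one-line consequence of `ColourTrace.adMat_transpose` (`(adMat τ X)ᵀ = −adMat τ X`, no hypothesis) and of the
landed real Jacobi `adMat_ibr_gen`.  PAIR-SWAPPED: `(A_X A_Y)ᵀ = A_Y A_X` — the words cwSeagull `½A_cA_d`, cwSpinR `¼A_dA_c`,
cwSpinL `−¼A_cA_d`, pwSpinL `−½A_cA_d`, pwSpinR `½A_dA_c` transpose to the SAME word type at the swapped background pair `(d,c)`;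
SYMMETRIC: the anticommutator `{A_X,A_Y}` (cwTrans `−¼{A_c,A_d}`) and the square `A_X A_X`; ANTISYMMETRIC: the commutator
`[A_X,A_Y]`, for generators `= adMat τ (i[τ_c,τ_d])` (cwAcc `−¼·`, pwScalar `¼·`).  The scalar-slot word cwScalar stays «neither»
(its antisymmetric part is `⅛·ad[t_c,t_d]` by `rntr_pairScalar_entry`; its symmetric part is not of adjoint type and is not
re-expressed here).  Symmetrisation `M ↦ ½(M + Mᵀ)` never changes a TRACED weight (`trace_half_add_transpose`), and an
antisymmetric colour matrix weighs `0` (`trace_eq_zero_of_transpose_eq_neg`; cf. `ColourTraceAdjoint.trace_adMat_eq_zero`). -/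

section Transpose

variable (τ : C → Matrix (Fin N) (Fin N) ℂ)

omit [DecidableEq C] in
/-- the trace of an ANTISYMMETRIC real matrix vanishes. [folklore] -/
theorem trace_eq_zero_of_transpose_eq_neg {M : Matrix C C ℝ} (h : Mᵀ = -M) : M.trace = 0 := by
  have ht : M.trace = (-M).trace := by rw [← h, Matrix.trace_transpose]
  rw [Matrix.trace_neg] at ht
  linarith

omit [DecidableEq C] in
/-- SYMMETRISATION DOES NOT CHANGE A TRACED WEIGHT: `trace (½(M + Mᵀ)) = trace M`. [folklore] -/
theorem trace_half_add_transpose (M : Matrix C C ℝ) : ((2 : ℝ)⁻¹ • (M + Mᵀ)).trace = M.trace := by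
  rw [Matrix.trace_smul, Matrix.trace_add, Matrix.trace_transpose, smul_eq_mul]
  ring

omit [DecidableEq C] in
/-- **PAIR SWAP**: `(A_X · A_Y)ᵀ = A_Y · A_X` for any two adjoint-action matrices (both factors are antisymmetric). [folklore] -/
theorem adMat_mul_transpose (X Y : Matrix (Fin N) (Fin N) ℂ) :
    (adMat τ X * adMat τ Y)ᵀ = adMat τ Y * adMat τ X := by
  rw [Matrix.transpose_mul, adMat_transpose, adMat_transpose, neg_mul_neg]

omit [DecidableEq C] in
/-- the SQUARE `A_X · A_X` is symmetric. [folklore] -/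
theorem adMat_mul_self_transpose (X : Matrix (Fin N) (Fin N) ℂ) :
    (adMat τ X * adMat τ X)ᵀ = adMat τ X * adMat τ X :=
  adMat_mul_transpose τ X X

omit [DecidableEq C] in
/-- the ANTICOMMUTATOR `A_X A_Y + A_Y A_X` is SYMMETRIC (an3's cwTrans = `−¼` of it at `X = τ_c, Y = τ_d`). [folklore] -/
theorem adMat_anticomm_transpose (X Y : Matrix (Fin N) (Fin N) ℂ) :
    (adMat τ X * adMat τ Y + adMat τ Y * adMat τ X)ᵀ = adMat τ X * adMat τ Y + adMat τ Y * adMat τ X := by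
  rw [Matrix.transpose_add, adMat_mul_transpose, adMat_mul_transpose, add_comm]

omit [DecidableEq C] in
/-- the COMMUTATOR `A_X A_Y − A_Y A_X` is ANTISYMMETRIC. [folklore] -/
theorem adMat_comm_transpose (X Y : Matrix (Fin N) (Fin N) ℂ) :
    (adMat τ X * adMat τ Y - adMat τ Y * adMat τ X)ᵀ = -(adMat τ X * adMat τ Y - adMat τ Y * adMat τ X) := by
  rw [Matrix.transpose_sub, adMat_mul_transpose, adMat_mul_transpose, neg_sub]

omit [DecidableEq C] in
/-- hence the commutator of two adjoint matrices weighs ZERO under the colour trace. [folklore] -/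
theorem trace_adMat_comm (X Y : Matrix (Fin N) (Fin N) ℂ) :
    (adMat τ X * adMat τ Y - adMat τ Y * adMat τ X).trace = 0 :=
  trace_eq_zero_of_transpose_eq_neg (adMat_comm_transpose τ X Y)

omit [DecidableEq C] in
/-- SYMMETRIC/ANTISYMMETRIC SPLIT: `A_X A_Y = ½(A_X A_Y + A_Y A_X) + ½(A_X A_Y − A_Y A_X)`, the first summand symmetric, the
second antisymmetric (`adMat_anticomm_transpose`, `adMat_comm_transpose`). [folklore] -/
theorem adMat_mul_eq_half_anticomm_add_half_comm (X Y : Matrix (Fin N) (Fin N) ℂ) :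
    adMat τ X * adMat τ Y = (2 : ℝ)⁻¹ • (adMat τ X * adMat τ Y + adMat τ Y * adMat τ X)
      + (2 : ℝ)⁻¹ • (adMat τ X * adMat τ Y - adMat τ Y * adMat τ X) := by
  rw [← smul_add, add_add_sub_cancel, ← two_smul ℝ (adMat τ X * adMat τ Y), smul_smul, inv_mul_cancel₀ two_ne_zero,
    one_smul]

omit [DecidableEq C] in
/-- the symmetric part of `A_X A_Y` IS the half anticommutator: `½(A_XA_Y + (A_XA_Y)ᵀ) = ½(A_XA_Y + A_YA_X)`. [folklore] -/
theorem half_add_transpose_adMat_mul (X Y : Matrix (Fin N) (Fin N) ℂ) :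
    (2 : ℝ)⁻¹ • (adMat τ X * adMat τ Y + (adMat τ X * adMat τ Y)ᵀ)
      = (2 : ℝ)⁻¹ • (adMat τ X * adMat τ Y + adMat τ Y * adMat τ X) := by
  rw [adMat_mul_transpose]

end Transpose

section TransposeGen

variable {τ : C → Matrix (Fin N) (Fin N) ℂ}

/-- FOR GENERATORS the antisymmetric part of `A_c A_d` is the colour matrix of `ad[t_c,t_d]`:
`A_cA_d − (A_cA_d)ᵀ = adMat τ (i[τ_c,τ_d])` (real Jacobi `adMat_ibr_gen`). [folklore] -/
theorem adMat_gen_mul_sub_transpose (hτ : Complete τ) (ho : TrOrthonormal τ) (hH : ∀ c, (τ c).IsHermitian) (hN : N ≠ 0)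
    (c d : C) :
    adMat τ (τ c) * adMat τ (τ d) - (adMat τ (τ c) * adMat τ (τ d))ᵀ = adMat τ (ibr (τ c) (τ d)) := by
  rw [adMat_mul_transpose, adMat_ibr_gen hτ ho hH hN]

/-- … so `A_cA_d = ½{A_c,A_d} + ½·adMat τ (i[τ_c,τ_d])`: the word colour matrices cwSeagull/cwSpin*/pwSpin* are a SYMMETRIC
anticommutator part plus a multiple of the ANTISYMMETRIC, trace-free `ad[t_c,t_d]`. [folklore] -/
theorem adMat_gen_mul_decomp (hτ : Complete τ) (ho : TrOrthonormal τ) (hH : ∀ c, (τ c).IsHermitian) (hN : N ≠ 0) (c d : C) :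
    adMat τ (τ c) * adMat τ (τ d) = (2 : ℝ)⁻¹ • (adMat τ (τ c) * adMat τ (τ d) + adMat τ (τ d) * adMat τ (τ c))
      + (2 : ℝ)⁻¹ • adMat τ (ibr (τ c) (τ d)) := by
  rw [adMat_ibr_gen hτ ho hH hN]
  exact adMat_mul_eq_half_anticomm_add_half_comm τ (τ c) (τ d)

omit [DecidableEq C] in
/-- the colour matrix of `ad[t_c,t_d]` is ANTISYMMETRIC (cwAcc, pwScalar): an instance of `ColourTrace.adMat_transpose`, recorded in
the commutator form `(A_cA_d − A_dA_c)ᵀ = A_dA_c − A_cA_d` for by-name use. [folklore] -/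
theorem adMat_gen_comm_transpose (τ : C → Matrix (Fin N) (Fin N) ℂ) (c d : C) :
    (adMat τ (τ c) * adMat τ (τ d) - adMat τ (τ d) * adMat τ (τ c))ᵀ
      = adMat τ (τ d) * adMat τ (τ c) - adMat τ (τ c) * adMat τ (τ d) := by
  rw [adMat_comm_transpose, neg_sub]

/-- and it transposes to the SWAPPED background pair: `(adMat τ (i[τ_c,τ_d]))ᵀ = adMat τ (i[τ_d,τ_c])`. [folklore] -/
theorem adMat_ibr_gen_transpose (hτ : Complete τ) (ho : TrOrthonormal τ) (hH : ∀ c, (τ c).IsHermitian) (hN : N ≠ 0)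
    (c d : C) : (adMat τ (ibr (τ c) (τ d)))ᵀ = adMat τ (ibr (τ d) (τ c)) := by
  rw [adMat_ibr_gen hτ ho hH hN, adMat_ibr_gen hτ ho hH hN, adMat_gen_comm_transpose]

/-- N = 2 CHECK by direct computation (Pauli family of `Beta.ColourTrace`): the pair swap on the adjoint matrices of `σ₁, σ₂`. -/
example : (adMat pauli (pauli 0) * adMat pauli (pauli 1))ᵀ = adMat pauli (pauli 1) * adMat pauli (pauli 0) :=
  adMat_mul_transpose pauli (pauli 0) (pauli 1)

end TransposeGen

end Literature.MathematicalPhysics.QuantumFieldTheory.Balaban1983to89.Beta.ColourWordMatrices
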